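import Summits.BirchSwinnertonDyer.BirchSwinnertonDyer.Theorems.KimAtThreeDeepLowerOffStratumLevelLoweringVatsalIharaRows
import Summits.BirchSwinnertonDyer.BirchSwinnertonDyer.Theorems.KimAtThreeDeepLowerOffStratumLevelLoweringConditionOne
import Summits.BirchSwinnertonDyer.BirchSwinnertonDyer.Theorems.KimAtThreeDeepLowerOffStratumLevelLoweringCanonicalPeriod
import Literature.NumberTheory.EllipticCurves.LevelLoweringGamma0AtThree
import HarnessLib

/-!
# Route `KimAtThreeKolyvagin` (rung W2), crux `DeepLowerAtThreeOffKatoStratum` (item 19679), registered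
# stub `stub_nonAdditive`, ROAD (b): the SEMISTABLE depth-`1` Tamagawa rows from NAMED FACTS — Ribet's
# level-lowered newform (R1) BY NAME, Condition 1 (R2) and the canonical period (R3′) DISCHARGED

Cell `bsd-addord`, seat `bsd-addord-w2-acc2` (PROGRAMME PART 1b, ACCEL-LIST row (2)), gen 5; item
`stmt-BirchSwinnertonDyer-19679` (OWNER w2-c2 assembles; `--supports`, closes nothing). Gen 4's ★
`…VatsalIharaRows.stub_nonAdditive_semistable_of_vatsal_of_ihara` displayed, after nine named facts: the
level-`N/q` newform `g` with its prime congruences (R1), a root `β ≡ q`, Vatsal's Condition 1 for `D₀.f` and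
`ι₁ g − β ι_q g` (R2), the normalisation `Ω` with a unit cycle `γ₀` (R3′) and one non-Eisenstein numeral
`r₀ ≡ 1 (mod N)`. THIS FILE feeds all but the last from the tree:

* (R1) = the NAMED FACT `ribet1990_levelLowering_gamma0_newform_at_three` (Ribet 1990 Thm. 1.1 in
  Diamond's `Γ₀` packaging at `p = 3`, typed by `hubbard-fast-lit`, p489962) — hypotheses = the row
  conditions `3 ∣ ord_q Δ`, `3 ∤ ord_ℓ Δ` (`ℓ ∣ M`, `ℓ ≠ 3`), `3 ∣ M → 3 ∤ ord_3 Δ`, `M` squarefree, `q ≠ 3`;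
* the root `β ≡ q` — `…ConditionOne.exists_root_valuation_sub_lt_one`;
* (R2) — `…ConditionOne.hasSimpleHeckeGenEigenspace_of_isNewform0` / `…_stab_of_ne`, with `α ≠ β` FREE for
  `q ≢ 1 (mod 3)` (`sub_ne_of_mod_three_ne_one`; the case `q ≡ 1 (mod 3)` needs Coleman–Edixhoven 1998 Thm. 2.1
  and is the sequel file `…LevelLoweringRibetRowsCE`);
* (R3′) — `…CanonicalPeriod.exists_period_integral_unit_cycle` at the numeral `r₀` (its unit
  `a_{r₀}(g) − r₀ − 1` comes from `a_{r₀}(g) ≡ a_{r₀}(E)` and `3 ∤ a_{r₀}(E) − r₀ − 1`).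

★ `stub_nonAdditive_semistable_of_ribet_of_ne` (core, `α ≠ β` as a decision procedure) and
★ `stub_nonAdditive_semistable_of_ribet_of_mod_three_ne_one` (for `q ≢ 1 (mod 3)`): the 19679 rows
`¬Addv ∧ Semistable ∧ v₃(∏ c_ℓ) ≤ 1 ∧ (ordinary if good)` whose Tamagawa-`3` prime `q` is split multiplicative
with `ρ̄_{E,3}` unramified exactly at `q`, from TEN NAMED FACTS + ONE displayed numeral: a prime
`r₀ ∤ N`, `r₀ ≡ 1 (mod N)`, `3 ∤ a_{r₀}(E) − r₀ − 1` (Chebotarev in `ℚ(E[3], ζ_N)`; the last residual of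
ROAD (b)). Theorems only; nothing booked; BSD is not proved by any of this.

## References

* K. A. Ribet, Invent. Math. 100 (1990), Thm. 1.1 [Ribet1990]; F. Diamond, *The refined conjecture of Serre*
  (1995), Thm. 6.4, Cor. 6.5 [Diamond1995RefinedSerre].
* V. Vatsal, Duke Math. J. 98 (1999), §1 [Vatsal1999]; R. Greenberg, V. Vatsal, Invent. Math. 142 (2000), §3
  [GreenbergVatsal2000]; K. A. Ribet, Proc. ICM 1983, Thm. 4.1 [Ribet1984ICM].
* C. Skinner (2016), Thm. C [Skinner2016PacificMC]; B. Mazur (1978), Cor. 4.1 [Mazur1978]; C.-H. Kim, Conj. 1.10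
  [Kim2022StructureSelmer].
-/

set_option autoImplicit false
-- the Theorems namespace of a single-conjunct summit repeats the summit name by design (D-0017)
set_option linter.dupNamespace false

noncomputable section

open scoped MatrixGroups ModularForm Classical NNReal

open CongruenceSubgroup WeierstrassCurve Literature.NumberTheory.EllipticCurves
  Literature.NumberTheory.EllipticCurves.ModularForms

namespace Summit.BirchSwinnertonDyer.BirchSwinnertonDyer.Theorems.KimAtThreeDeepLowerOffStratumLevelLoweringRibetRows

open Summit.BirchSwinnertonDyer.BirchSwinnertonDyer.Theorems.KimAtThreeDeepLowerOffStratumLevelLoweringVatsal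
open Summit.BirchSwinnertonDyer.BirchSwinnertonDyer.Theorems.KimAtThreeDeepLowerOffStratumLevelLoweringVatsalStabRows
open Summit.BirchSwinnertonDyer.BirchSwinnertonDyer.Theorems.KimAtThreeDeepLowerOffStratumLevelLoweringVatsalIharaRows
open Summit.BirchSwinnertonDyer.BirchSwinnertonDyer.Theorems.KimAtThreeDeepLowerOffStratumLevelLoweringConditionOne
open Summit.BirchSwinnertonDyer.BirchSwinnertonDyer.Theorems.KimAtThreeDeepLowerOffStratumLevelLoweringCanonicalPeriod
open Literature.NumberTheory.EllipticCurves.Rank1Residual Literature.NumberTheory.EllipticCurves.Rank1Residual.Typed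
  Literature.NumberTheory.EllipticCurves.Skinner2016 Literature.NumberTheory.Automorphic

/-! ### §1 From the numeral `3 ∤ a_{r₀}(E) − r₀ − 1` to the unit `a_{r₀}(g) − r₀ − 1` -/

section Numeral

/-- An integer not divisible by `3` is a `3`-adic unit in `ℚ̄₃`. [folklore] -/
theorem norm_intCast_eq_one_of_not_dvd {z : ℤ} (hz : ¬ (3 : ℤ) ∣ z) : ‖(z : PadicAlgCl 3)‖ = 1 := by
  refine le_antisymm (norm_intCast_le_one z) ?_
  by_contra h
  push Not at h
  rw [show (z : PadicAlgCl 3) = ((z : ℚ_[3]) : PadicAlgCl 3) by rfl, PadicAlgCl.norm_extends,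
    Padic.norm_intCast_lt_one_iff] at h
  exact hz h

/-- **The non-Eisenstein unit for `g` from the numeral for `E`**: if `a_{r₀}(f) = a_{r₀}(E) ∈ ℤ` (the newform of
`W₀`), `a_{r₀}(f) ≡ a_{r₀}(g) (mod 𝔪)` and `3 ∤ a_{r₀}(E) − r₀ − 1`, then `a_{r₀}(g) − (r₀ + 1)` is a unit.
[folklore] -/
theorem valuation_cuspCoeff_sub_eq_one_of_congr (ι : PadicAlgCl 3 ≃+* ℂ) {M : ℕ} {g : CuspForm (Gamma0 M) 2}
    {r₀ : ℕ} {a : ℤ} (ha : ¬ (3 : ℤ) ∣ a - (r₀ + 1))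
    (hcong : Valued.v (ι.symm ((a : ℂ) - cuspCoeff g r₀)) < 1) :
    Valued.v (ι.symm (cuspCoeff g r₀ - (r₀ + 1))) = 1 := by
  rw [valuation_eq_one_iff]
  have hu : ‖(((a - (r₀ + 1) : ℤ)) : PadicAlgCl 3)‖ = 1 := norm_intCast_eq_one_of_not_dvd ha
  have hsmall : ‖ι.symm ((a : ℂ) - cuspCoeff g r₀)‖ < 1 := valuation_lt_one_iff.mp hcong
  have heq : ι.symm (cuspCoeff g r₀ - (r₀ + 1)) =
      (((a - (r₀ + 1) : ℤ)) : PadicAlgCl 3) + -ι.symm ((a : ℂ) - cuspCoeff g r₀) := by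
    push_cast
    rw [map_sub, map_sub, map_add, map_intCast, map_natCast, map_one]
    ring
  rw [heq]
  refine le_antisymm ?_ ?_
  · refine (PadicAlgCl.isNonarchimedean 3 _ _).trans (max_le hu.le ?_)
    rw [norm_neg]; exact hsmall.le
  · -- `‖u + s‖ = ‖u‖` for `‖s‖ < ‖u‖`
    have h := IsUltrametricDist.norm_add_eq_max_of_norm_ne_norm
      (x := (((a - (r₀ + 1) : ℤ)) : PadicAlgCl 3)) (y := -ι.symm ((a : ℂ) - cuspCoeff g r₀))
      (by rw [hu, norm_neg]; exact (ne_of_lt hsmall).symm)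
    rw [h, hu]
    exact le_max_left _ _

end Numeral

/-! ### §2 ★ The semistable depth-`1` rows from named facts + the row conditions + one numeral -/

section Rows

/-- **Core assembly** (shared by the two ★): everything of gen 4's
`stub_nonAdditive_semistable_of_vatsal_of_ihara` after `hsplit`, produced from (R1) BY NAME, the
Condition-1 theorems, the canonical-period theorem and the numeral `r₀`, GIVEN a decision procedure for
`α ≠ β` (`hαβ`, fed below either by `q ≢ 1 (mod 3)` or by Coleman–Edixhoven). [cite: Ribet1990, Thm. 1.1]
[cite: Diamond1995RefinedSerre, Thm. 6.4 and Cor. 6.5] [cite: Vatsal1999, §1 (1.2), (1.6), Thm. (1.13)]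
[cite: Ribet1984ICM, Thm. 4.1] -/
theorem stub_nonAdditive_semistable_of_ribet_of_ne
    (hR : ribet1990_levelLowering_gamma0_newform_at_three)
    (hV : vatsal1999_plusSymbol_congruence) (hGV : greenbergVatsal2000_plusSymbol_congruence)
    (hI : ribet1984_iharaLemma)
    (hSk : Skinner2016.thmC_padicValRat_bsd_rank_zero)
    (hmod : hasEntireLFunction_rat) (hGZK : rank_eq_analyticRank_of_analyticRank_le_one)
    (hM : mazur_not_dvd_maninConstant_of_odd)
    (hBCDT : exists_isNewformOf) (hLL' : diamond1995_refinedSerre)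
    (W₀ : WeierstrassCurve ℚ) [W₀.IsElliptic] [W₀.IsGloballyMinimal]
    (htower : ∀ n : ℕ, W₀.HasSurjectiveModNGaloisRep (3 ^ n : ℕ)) (hfin : Finite W₀.sha)
    {M q : ℕ} [NeZero M] [NeZero q] [Fact q.Prime] [NeZero (M * q)] (hN : M * q = W₀.conductorNorm ℤ)
    (D₀ : ModularParametrizationData W₀ (M * q))
    (hopt : ∀ z ∈ D₀.L.lattice, ∃ w ∈ periodLattice D₀.f, z = D₀.c * w)
    (hdeg : ∀ (W₂ : WeierstrassCurve ℚ) [W₂.IsElliptic] (D₂ : ModularParametrizationData W₂ (M * q)),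
      D₂.f = D₀.f → D₀.modularDegree ≤ D₂.modularDegree)
    (hint : ∀ r : ℚ, ratPlusSymbol D₀.f r ≠ 0 → 0 ≤ padicValRat 3 (ratPlusSymbol D₀.f r))
    (hord : kuriharaVanishingOrder W₀ 3 D₀.f = 0)
    (hnA : ¬ (haveI : Fact (Nat.Prime 3) := ⟨Nat.prime_three⟩; Addv W₀ 3))
    (hsst : Semistable W₀) (hordinary : W₀.HasGoodReductionAtPrime 3 → ¬ (3 : ℤ) ∣ W₀.frobeniusTrace 3)
    (hv : padicValNat 3 W₀.tamagawaProduct ≤ 1)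
    (hsplit : W₀.HasSplitMultiplicativeReductionAtPrime q)
    -- the row conditions of (R1)
    (hq3 : q ≠ 3) (hqM : ¬ q ∣ M) (hMsq : Squarefree M) (hqΔ : (3 : ℤ) ∣ padicValRat q W₀.Δ)
    (hℓΔ : ∀ ℓ : ℕ, ℓ.Prime → ℓ ∣ M → ℓ ≠ 3 → ¬ (3 : ℤ) ∣ padicValRat ℓ W₀.Δ)
    (h3Δ : 3 ∣ M → ¬ (3 : ℤ) ∣ padicValRat 3 W₀.Δ)
    -- `α ≠ β` for every level-`M` newform and root (decided below)
    (ι : PadicAlgCl 3 ≃+* ℂ)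
    (hαβ : ∀ g : CuspForm (Gamma0 M) 2, IsNewform0 g → Valued.v (ι.symm (cuspCoeff g q - (q + 1))) < 1 →
      ∀ β : ℂ, β ^ 2 - cuspCoeff g q * β + q = 0 → Valued.v (ι.symm (β - q)) < 1 → cuspCoeff g q - β ≠ β)
    -- the numeral
    {r₀ : ℕ} (hr₀ : r₀.Prime) (hr₀S : ¬ r₀ ∣ M * q) (hr₀1 : r₀ ≡ 1 [MOD M * q])
    (hE₀ : ¬ (3 : ℤ) ∣ W₀.frobeniusTrace r₀ - (r₀ + 1)) :
    ∃ d : ℕ, kuriharaPartialDeepInfty W₀ 3 D₀.f = d ∧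
      kuriharaPartial W₀ 3 D₀.f 0 ≤
        ((padicValNat 3 (Nat.card (AddCommGroup.primaryComponent W₀.sha 3)) + d : ℕ) : ℕ∞) := by
  have hq : q.Prime := Fact.out
  have hsurj : W₀.HasSurjectiveModNGaloisRep 3 := by simpa using htower 1
  -- (R1) BY NAME
  obtain ⟨g, hg, hcℓ, haq⟩ := hR W₀ hsurj hq3 hqM hMsq hN hsplit hqΔ hℓΔ h3Δ D₀ ι
  -- the root `β ≡ q`
  obtain ⟨β, hβ, hβq⟩ :=
    exists_root_valuation_sub_lt_one ι (valuation_cuspCoeff_le_one_of_isNewform0 hg ι q) q haq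
  -- (R2)
  have h1 : M * 1 ∣ M * q := mul_dvd_mul_left M (one_dvd q)
  have hfC : HasSimpleHeckeGenEigenspace D₀.f := hasSimpleHeckeGenEigenspace_of_isNewform0 D₀.isNewformOf.1
  have hgC : HasSimpleHeckeGenEigenspace
      (iota M (M * q) 1 2 (mul_dvd_mul_left M (one_dvd q)) g - β • iota M (M * q) q 2 dvd_rfl g) :=
    hasSimpleHeckeGenEigenspace_stab_of_ne hg β h1 dvd_rfl hq hqM hβ (hαβ g hg haq β hβ hβq)
  -- the unit `a_{r₀}(g) − r₀ − 1` from the numeral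
  haveI : Fact r₀.Prime := ⟨hr₀⟩
  have hr₀q : r₀ ≠ q := by rintro rfl; exact hr₀S (dvd_mul_left r₀ M)
  have hr₀N : ¬ r₀ ∣ W₀.conductorNorm ℤ := by rwa [← hN]
  have hfr₀ : cuspCoeff D₀.f r₀ = (W₀.frobeniusTrace r₀ : ℂ) := by
    rw [D₀.isNewformOf.2 r₀, LFunction_apply_prime_eq_frobeniusTrace W₀ r₀
      (hasGoodReductionAtPrime_of_not_dvd_conductorNorm W₀ hr₀N)]
  have hunit : Valued.v (ι.symm (cuspCoeff g r₀ - (r₀ + 1))) = 1 := by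
    refine valuation_cuspCoeff_sub_eq_one_of_congr ι hE₀ ?_
    rw [← hfr₀]
    exact hcℓ r₀ hr₀ hr₀q
  -- (R3′)
  have hr₀M : ¬ r₀ ∣ M := fun h ↦ hr₀S (h.mul_right q)
  obtain ⟨Ω, hΩint, γ₀, hγ₀, hΩunit⟩ := exists_period_integral_unit_cycle ι hMsq hg hr₀ hr₀M hunit
  exact stub_nonAdditive_semistable_of_vatsal_of_ihara hV hGV hI hSk hmod hGZK hM hBCDT hLL' W₀ htower hfin hN D₀
    hopt hdeg hint hord hnA hsst hordinary hv hsplit ι g hg hqM hcℓ haq β hβ hβq hfC hgC Ω hΩint γ₀ hγ₀ hΩunit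
    hr₀ hr₀S hr₀1 hunit

/-- ★ **`stub_nonAdditive` on its SEMISTABLE depth-`1` rows whose Tamagawa-`3` prime `q` has `q ≢ 1 (mod 3)`,
from TEN NAMED FACTS** (`hR hV hGV hI hSk hmod hGZK hM hBCDT hLL'`) + the registered stub's binders VERBATIM
(level written `M·q`) + the row conditions (semistable, ordinary-if-good, `v₃(∏ c_ℓ) ≤ 1`, `q` split
multiplicative with `3 ∣ ord_q Δ`, `3 ∤ ord_ℓ Δ` at the other bad `ℓ ≠ 3`, `3 ∣ M → 3 ∤ ord_3 Δ`, `q ≠ 3`,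
`q % 3 ≠ 1`) + ONE displayed numeral: a prime `r₀ ∤ Mq`, `r₀ ≡ 1 (mod Mq)`, `3 ∤ a_{r₀}(E) − r₀ − 1`. NO displayed
`g`, `β`, Condition 1, `Ω`, `γ₀`. [cite: Ribet1990, Thm. 1.1] [cite: Diamond1995RefinedSerre, Thm. 6.4 and Cor. 6.5]
[cite: Vatsal1999, §1 (1.6), Thm. (1.13)] [cite: GreenbergVatsal2000, §3 (17)–(19)] [cite: Ribet1984ICM, Thm. 4.1]
[cite: Skinner2016PacificMC, Thm. C (§1)] [cite: Mazur1978, Cor. 4.1] [cite: Kim2022StructureSelmer, Conj. 1.10 (PDF p. 8)] -/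
theorem stub_nonAdditive_semistable_of_ribet_of_mod_three_ne_one
    (hR : ribet1990_levelLowering_gamma0_newform_at_three)
    (hV : vatsal1999_plusSymbol_congruence) (hGV : greenbergVatsal2000_plusSymbol_congruence)
    (hI : ribet1984_iharaLemma)
    (hSk : Skinner2016.thmC_padicValRat_bsd_rank_zero)
    (hmod : hasEntireLFunction_rat) (hGZK : rank_eq_analyticRank_of_analyticRank_le_one)
    (hM : mazur_not_dvd_maninConstant_of_odd)
    (hBCDT : exists_isNewformOf) (hLL' : diamond1995_refinedSerre) :
    ∀ (W₀ : WeierstrassCurve ℚ) [W₀.IsElliptic] [W₀.IsGloballyMinimal],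
      (∀ n : ℕ, W₀.HasSurjectiveModNGaloisRep (3 ^ n : ℕ)) → Finite W₀.sha →
      ∀ {M q : ℕ} [NeZero M] [NeZero q] [Fact q.Prime] [NeZero (M * q)], M * q = W₀.conductorNorm ℤ →
      ∀ (D₀ : ModularParametrizationData W₀ (M * q)),
        (∀ z ∈ D₀.L.lattice, ∃ w ∈ periodLattice D₀.f, z = D₀.c * w) →
        (∀ (W₂ : WeierstrassCurve ℚ) [W₂.IsElliptic] (D₂ : ModularParametrizationData W₂ (M * q)),
          D₂.f = D₀.f → D₀.modularDegree ≤ D₂.modularDegree) →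
        (∀ r : ℚ, ratPlusSymbol D₀.f r ≠ 0 → 0 ≤ padicValRat 3 (ratPlusSymbol D₀.f r)) →
        kuriharaVanishingOrder W₀ 3 D₀.f = 0 →
        ¬ (haveI : Fact (Nat.Prime 3) := ⟨Nat.prime_three⟩; Addv W₀ 3) →
        Semistable W₀ →
        (W₀.HasGoodReductionAtPrime 3 → ¬ (3 : ℤ) ∣ W₀.frobeniusTrace 3) →
        padicValNat 3 W₀.tamagawaProduct ≤ 1 →
        W₀.HasSplitMultiplicativeReductionAtPrime q →
        q ≠ 3 → ¬ q ∣ M → Squarefree M → (3 : ℤ) ∣ padicValRat q W₀.Δ →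
        (∀ ℓ : ℕ, ℓ.Prime → ℓ ∣ M → ℓ ≠ 3 → ¬ (3 : ℤ) ∣ padicValRat ℓ W₀.Δ) →
        (3 ∣ M → ¬ (3 : ℤ) ∣ padicValRat 3 W₀.Δ) →
        q % 3 ≠ 1 →
        ∀ {r₀ : ℕ}, r₀.Prime → ¬ r₀ ∣ M * q → r₀ ≡ 1 [MOD M * q] →
          ¬ (3 : ℤ) ∣ W₀.frobeniusTrace r₀ - (r₀ + 1) →
        ∃ d : ℕ, kuriharaPartialDeepInfty W₀ 3 D₀.f = d ∧
          kuriharaPartial W₀ 3 D₀.f 0 ≤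
            ((padicValNat 3 (Nat.card (AddCommGroup.primaryComponent W₀.sha 3)) + d : ℕ) : ℕ∞) := by
  intro W₀ _ _ htower hfin M q _ _ _ _ hN D₀ hopt hdeg hint hord hnA hsst hordinary hv hsplit hq3 hqM hMsq hqΔ hℓΔ
    h3Δ hq31 r₀ hr₀ hr₀S hr₀1 hE₀
  set ι : PadicAlgCl 3 ≃+* ℂ := Classical.choice (PadicAlgCl.nonempty_ringEquiv_complex 3) with hι
  exact stub_nonAdditive_semistable_of_ribet_of_ne hR hV hGV hI hSk hmod hGZK hM hBCDT hLL' W₀ htower hfin hN D₀ hopt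
    hdeg hint hord hnA hsst hordinary hv hsplit hq3 hqM hMsq hqΔ hℓΔ h3Δ ι
    (fun g _ haq β _ hβq ↦ sub_ne_of_mod_three_ne_one ι hq31 haq hβq) hr₀ hr₀S hr₀1 hE₀

end Rows

end Summit.BirchSwinnertonDyer.BirchSwinnertonDyer.Theorems.KimAtThreeDeepLowerOffStratumLevelLoweringRibetRows

end
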